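import Mathlib
import HarnessLib
import Summits.CriticalPhenomena.PercolationContinuityZ3.Theorems.PercNearOneGluingNoHeavyLowerTailKnQuestion8AntitheticWedgeTransfer

/-!
# `NoHeavyLowerTail` (crux stmt-CriticalPhenomena-4575), antithetic vdBHK programme: the ZONE-TRANSFER LEMMA — the rearrangement inequality for an
# arbitrary ZONE transfers antipodal Kleitman to the 'pendant atom under a top' extension `T_Z(X)` (generalises `AntitheticWedgeTransfer`)

Support file (seat `prim-ineq-gen-7` gen 57; `--supports stmt-CriticalPhenomena-4575`).  No `sorry`, no definitions.
Memo: run/shared/lean/prim/prim-ineq-gen-7/FINDING-NEST-g57.md (this generation); FINDING-FENCE-g51.md (the half case).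

SETTING.  `X` a finite partial order with a self-map `ι` (in the application the colour-swap involution of a colouring poset `X = Ω_Q`), antipodal
Kleitman (AK) in the up-set form `#(V ∩ ι Y) ≤ #(V ∩ Y)` for all up-sets `V, Y`, and two subsets `Z, U ⊆ X` (in the application `Z = {D all red}`
for a nonempty down-set `D` of `Q` — a down-set of `X` — and `U = ι Z = {D all blue}`, an up-set, with `Z ∩ U = ∅`; when `D = {a}` is a single atom,
`Z = L = {a red}` is a HALF and `U = X ∖ L`, the setting of `AntitheticWedgeTransfer`).
THE ZONE EXTENSION `T_Z(X)` is `X × {1,2,3,4}` (sheets = colours `(vR,tB), (vR,tR), (vB,tB), (vB,tR)` of a NEW ATOM `v` and a NEW TOP `t` above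
`D ∪ {v}`), ordered by `(s,i) ≤ (s',i)` iff `s ≤ s'`; `1 → 3`, `2 → 4`, `1 → 4` iff `s ≤ s'`; `3 → 4` iff moreover `s ∉ U`; `1 → 2` iff moreover `s' ∉ Z`;
`2 → 3` iff moreover `s ∈ Z, s' ∈ U`; nothing else; involution `(s,i) ↦ (ι s, 5-i)`.  For `X = Ω_Q` this is EXACTLY `Ω_{Q + v + t}` (the sign-model
computation of the memo, §2; machine-checked relation by relation for all `(Q,D)` with `|Q| ≤ 3`, `checkz2.py`).  Its up-sets are the quadruples
`(A₁,A₂,A₃,A₄)` of up-sets of `X` with the ZONE PATTERN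
  `A₁ ⊆ A₃`, `A₂ ⊆ A₄`, `x ∈ A₃, x ∉ U, x ≤ y ⟹ y ∈ A₄`, `x ∈ A₁, x ≤ y, y ∉ Z ⟹ y ∈ A₂`, `x ∈ A₂ ∩ Z, x ≤ y, y ∈ U ⟹ y ∈ A₃`
(machine-checked both ways, loc. cit.), and AK of `T_Z(X)` reads `Σ_i #(A_i ∩ ι B_{5-i}) ≤ Σ_i #(A_i ∩ B_i)`.
THE ZONE REARRANGEMENT INEQUALITY ZR(X;Z,U) is the statement that for all pairs of zone-pattern quadruples
  `#(A₂ ∩ ι B₃) + #(A₃ ∩ ι B₂) ≤ #(A₂ ∩ B₂) + #(A₃ ∩ B₃) + #((A₄ ∖ A₁) ∩ (B₄ ∖ B₁))`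
(for a half this is literally the rearrangement inequality (R) of g50/g51).
* `AntitheticZoneTransfer.outer_nested` — every zone-pattern quadruple has `A₁ ⊆ A₄` (needs only `Z ∩ U = ∅`).
* `AntitheticZoneTransfer.zone_transfer` — **ZR ∧ AK(X) ⟹ AK(T_Z(X))**, proof `Φ = ZR(A,B) + AK(A₁,B₄) + AK(A₄,B₁)` via
  `AntitheticWedgeTransfer.spread_card`.
* `AntitheticZoneTransfer.ak_of_zr` — **ZR ⟹ AK(X)** (constant quadruples are zone-pattern quadruples), so a ZR-certificate needs no separate AK
  hypothesis.
CONSEQUENCES (memo §3; the hypotheses are machine-certified, not formalised): ZR holds with minimum exactly 0 for EVERY pair `(Q,D)` with `|Q| ≤ 4`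
and `D` any nonempty down-set (105 instances up to isomorphism; exact hybrid engine `rexactz` = pair-form reduction × min-closure); the `|Q| = 5`
instances needed at 7 elements are kit job j310373.  With the exact (R)-censuses of g51–g55 and THEOREM M of g49 the theorem(+census) class of
antipodal-Kleitman colouring posets becomes: ALL 317 β-acyclic 6-posets, 2,013 of the 2,032 β-acyclic 7-posets, 16,195 of the 16,780 β-acyclic
8-posets (g56: 305 / 1,875 / 14,576).
-/

namespace Summit.CriticalPhenomena.PercolationContinuityZ3.Theorems

open Finset

namespace AntitheticZoneTransfer

variable {X : Type*} [DecidableEq X]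

/-- In a zone-pattern quadruple the outer sheets are nested, `A₁ ⊆ A₄`: through sheet `3` on the zone (`x ∈ Z`, hence `x ∉ U`) and through
sheet `2` off the zone. [this work] -/
theorem outer_nested [PartialOrder X] (Z U : Finset X) (hZU : ∀ x, x ∈ Z → x ∉ U)
    (A₁ A₂ A₃ A₄ : Finset X) (a13 : A₁ ⊆ A₃) (a24 : A₂ ⊆ A₄)
    (a34 : ∀ x y, x ≤ y → x ∉ U → x ∈ A₃ → y ∈ A₄) (a12 : ∀ x y, x ≤ y → y ∉ Z → x ∈ A₁ → y ∈ A₂) :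
    A₁ ⊆ A₄ := by
  intro x hx
  by_cases hZ : x ∈ Z
  · exact a34 x x le_rfl (hZU x hZ) (a13 hx)
  · exact a24 (a12 x x le_rfl hZ hx)

/-- **ZONE TRANSFER: ZR ∧ AK(X) ⟹ AK(T_Z(X)).**  `X` AK in up-set form (`hAK`), `ι` any self-map, `Z, U ⊆ X` disjoint subsets (zone and
anti-zone); ZR for `(X;Z,U)` in the quadruple form (`hR`, quantified over all pairs of zone-pattern quadruples of up-sets).  Then every pair of
zone-pattern quadruples `(A₁,…,A₄)`, `(B₁,…,B₄)` satisfies the antipodal-Kleitman inequality of the zone extension `T_Z(X)`: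
`Σ_i #(A_i ∩ ι B_{5-i}) ≤ Σ_i #(A_i ∩ B_i)`.  For a half (`U = X ∖ Z`) this is `AntitheticWedgeTransfer.wedge_transfer`. [this work] -/
theorem zone_transfer [PartialOrder X] (ι : X → X)
    (hAK : ∀ V Y : Finset X, (∀ x y, x ≤ y → x ∈ V → y ∈ V) → (∀ x y, x ≤ y → x ∈ Y → y ∈ Y) →
      (V ∩ Y.image ι).card ≤ (V ∩ Y).card)
    (Z U : Finset X) (hZU : ∀ x, x ∈ Z → x ∉ U)
    (hR : ∀ A₁ A₂ A₃ A₄ B₁ B₂ B₃ B₄ : Finset X,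
      (∀ x y, x ≤ y → x ∈ A₁ → y ∈ A₁) → (∀ x y, x ≤ y → x ∈ A₂ → y ∈ A₂) →
      (∀ x y, x ≤ y → x ∈ A₃ → y ∈ A₃) → (∀ x y, x ≤ y → x ∈ A₄ → y ∈ A₄) →
      (∀ x y, x ≤ y → x ∈ B₁ → y ∈ B₁) → (∀ x y, x ≤ y → x ∈ B₂ → y ∈ B₂) →
      (∀ x y, x ≤ y → x ∈ B₃ → y ∈ B₃) → (∀ x y, x ≤ y → x ∈ B₄ → y ∈ B₄) →
      A₁ ⊆ A₃ → A₂ ⊆ A₄ → (∀ x y, x ≤ y → x ∉ U → x ∈ A₃ → y ∈ A₄) → (∀ x y, x ≤ y → y ∉ Z → x ∈ A₁ → y ∈ A₂) →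
      (∀ x y, x ≤ y → x ∈ Z → y ∈ U → x ∈ A₂ → y ∈ A₃) →
      B₁ ⊆ B₃ → B₂ ⊆ B₄ → (∀ x y, x ≤ y → x ∉ U → x ∈ B₃ → y ∈ B₄) → (∀ x y, x ≤ y → y ∉ Z → x ∈ B₁ → y ∈ B₂) →
      (∀ x y, x ≤ y → x ∈ Z → y ∈ U → x ∈ B₂ → y ∈ B₃) →
      (A₂ ∩ B₃.image ι).card + (A₃ ∩ B₂.image ι).card ≤
        (A₂ ∩ B₂).card + (A₃ ∩ B₃).card + ((A₄ \ A₁) ∩ (B₄ \ B₁)).card)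
    (A₁ A₂ A₃ A₄ B₁ B₂ B₃ B₄ : Finset X)
    (hA₁ : ∀ x y, x ≤ y → x ∈ A₁ → y ∈ A₁) (hA₂ : ∀ x y, x ≤ y → x ∈ A₂ → y ∈ A₂)
    (hA₃ : ∀ x y, x ≤ y → x ∈ A₃ → y ∈ A₃) (hA₄ : ∀ x y, x ≤ y → x ∈ A₄ → y ∈ A₄)
    (hB₁ : ∀ x y, x ≤ y → x ∈ B₁ → y ∈ B₁) (hB₂ : ∀ x y, x ≤ y → x ∈ B₂ → y ∈ B₂)
    (hB₃ : ∀ x y, x ≤ y → x ∈ B₃ → y ∈ B₃) (hB₄ : ∀ x y, x ≤ y → x ∈ B₄ → y ∈ B₄)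
    (a13 : A₁ ⊆ A₃) (a24 : A₂ ⊆ A₄) (a34 : ∀ x y, x ≤ y → x ∉ U → x ∈ A₃ → y ∈ A₄)
    (a12 : ∀ x y, x ≤ y → y ∉ Z → x ∈ A₁ → y ∈ A₂) (a23 : ∀ x y, x ≤ y → x ∈ Z → y ∈ U → x ∈ A₂ → y ∈ A₃)
    (b13 : B₁ ⊆ B₃) (b24 : B₂ ⊆ B₄) (b34 : ∀ x y, x ≤ y → x ∉ U → x ∈ B₃ → y ∈ B₄)
    (b12 : ∀ x y, x ≤ y → y ∉ Z → x ∈ B₁ → y ∈ B₂) (b23 : ∀ x y, x ≤ y → x ∈ Z → y ∈ U → x ∈ B₂ → y ∈ B₃) :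
    (A₁ ∩ B₄.image ι).card + (A₂ ∩ B₃.image ι).card + (A₃ ∩ B₂.image ι).card + (A₄ ∩ B₁.image ι).card ≤
      (A₁ ∩ B₁).card + (A₂ ∩ B₂).card + (A₃ ∩ B₃).card + (A₄ ∩ B₄).card := by
  classical
  have a14 : A₁ ⊆ A₄ := outer_nested Z U hZU A₁ A₂ A₃ A₄ a13 a24 a34 a12
  have b14 : B₁ ⊆ B₄ := outer_nested Z U hZU B₁ B₂ B₃ B₄ b13 b24 b34 b12
  have hr := hR A₁ A₂ A₃ A₄ B₁ B₂ B₃ B₄ hA₁ hA₂ hA₃ hA₄ hB₁ hB₂ hB₃ hB₄ a13 a24 a34 a12 a23 b13 b24 b34 b12 b23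
  have ak1 := hAK A₁ B₄ hA₁ hB₄
  have ak2 := hAK A₄ B₁ hA₄ hB₁
  have sp := AntitheticWedgeTransfer.spread_card A₁ A₄ B₁ B₄ a14 b14
  omega

/-- **ZR ⟹ AK(X).**  A constant quadruple `(V,V,V,V)` of an up-set is a zone-pattern quadruple (all five pattern conditions are instances of the
up-set property), and for two constant quadruples the zone rearrangement inequality reads `2·#(V ∩ ι Y) ≤ 2·#(V ∩ Y) + 0`.  Hence a poset that
satisfies ZR for some pair `(Z,U)` is antipodal Kleitman, and a ZR-certificate needs no separate AK hypothesis in `zone_transfer`. [this work] -/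
theorem ak_of_zr [PartialOrder X] (ι : X → X) (Z U : Finset X)
    (hR : ∀ A₁ A₂ A₃ A₄ B₁ B₂ B₃ B₄ : Finset X,
      (∀ x y, x ≤ y → x ∈ A₁ → y ∈ A₁) → (∀ x y, x ≤ y → x ∈ A₂ → y ∈ A₂) →
      (∀ x y, x ≤ y → x ∈ A₃ → y ∈ A₃) → (∀ x y, x ≤ y → x ∈ A₄ → y ∈ A₄) →
      (∀ x y, x ≤ y → x ∈ B₁ → y ∈ B₁) → (∀ x y, x ≤ y → x ∈ B₂ → y ∈ B₂) →
      (∀ x y, x ≤ y → x ∈ B₃ → y ∈ B₃) → (∀ x y, x ≤ y → x ∈ B₄ → y ∈ B₄) →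
      A₁ ⊆ A₃ → A₂ ⊆ A₄ → (∀ x y, x ≤ y → x ∉ U → x ∈ A₃ → y ∈ A₄) → (∀ x y, x ≤ y → y ∉ Z → x ∈ A₁ → y ∈ A₂) →
      (∀ x y, x ≤ y → x ∈ Z → y ∈ U → x ∈ A₂ → y ∈ A₃) →
      B₁ ⊆ B₃ → B₂ ⊆ B₄ → (∀ x y, x ≤ y → x ∉ U → x ∈ B₃ → y ∈ B₄) → (∀ x y, x ≤ y → y ∉ Z → x ∈ B₁ → y ∈ B₂) →
      (∀ x y, x ≤ y → x ∈ Z → y ∈ U → x ∈ B₂ → y ∈ B₃) →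
      (A₂ ∩ B₃.image ι).card + (A₃ ∩ B₂.image ι).card ≤
        (A₂ ∩ B₂).card + (A₃ ∩ B₃).card + ((A₄ \ A₁) ∩ (B₄ \ B₁)).card)
    (V Y : Finset X) (hV : ∀ x y, x ≤ y → x ∈ V → y ∈ V) (hY : ∀ x y, x ≤ y → x ∈ Y → y ∈ Y) :
    (V ∩ Y.image ι).card ≤ (V ∩ Y).card := by
  classical
  have hr := hR V V V V Y Y Y Y hV hV hV hV hY hY hY hY (subset_refl V) (subset_refl V)
    (fun x y hxy _ hx => hV x y hxy hx) (fun x y hxy _ hx => hV x y hxy hx) (fun x y hxy _ _ hx => hV x y hxy hx)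
    (subset_refl Y) (subset_refl Y)
    (fun x y hxy _ hx => hY x y hxy hx) (fun x y hxy _ hx => hY x y hxy hx) (fun x y hxy _ _ hx => hY x y hxy hx)
  have e1 : ((V \ V) ∩ (Y \ Y)).card = 0 := by simp
  omega

end AntitheticZoneTransfer

end Summit.CriticalPhenomena.PercolationContinuityZ3.Theorems
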